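/-
Copyright (c) 2026 the pub-hodgecm-mathlib formalisation cell (harness21).  Prover seat hodgecm-mathlib-K2E1-p16 (g2), Track B «K2-LIT» ENGINE E1, h413 = `stmt-HodgeConjecture-24833`,
route `HCCMUnconditional`, R90-S8 «ContSpec-n½» (dealer R90-CS-plan (g2)): D-S8-3 ED. 2 COROLLARIES — the intertwined coefficient of a `(χ₁, χ₂)`-section lies in the PAIR section space
`V(χ₁ʷ, χ₂; K′, ω)` (★ `chiSectionSpacePair`, K2-defs1 p862227), and the scattering coordinates in a basis of that space are holomorphic on `{2 < Re}` (`U(2,1)_{L∕L⁺}`).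
-/
import Summits.HodgeConjecture.HodgeConjecture.Theorems.K2E1ChiEisensteinSolvesXSystemU3          -- ★ row 4b (this seat, p861960): `intertwinedCoeff_mul_right_of_rightLaw`; brings ★ row 4a `isChiSectionPair_intertwinedCoeff_three`
import Summits.HodgeConjecture.HodgeConjecture.Theorems.K2E1ChiScatteringCoordsHolomorphicCMThree   -- ★ row 7c (this seat, p862021): `exists_scatteringCoords_cm_three`
import Summits.HodgeConjecture.HodgeConjecture.Theorems.K2E1ChiSectionSpaceU3PairDefs            -- ★ D-S8-3 ED. 2 (K2-defs1, p862227): `chiSectionSpacePair`, `mem_chiSectionSpacePair`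
import HarnessLib

/-!
# h413 ∕ Track B «K2-LIT», R90-S8 — `K2E1ChiScatteringCoordsPairCMThree`: THE INTERTWINED COEFFICIENT `φ̃_z·H^{z−2}` OF `φ ∈ V(χ₁, χ₂; K′, ω)` LIES IN `V(χ₁ʷ, χ₂; K′, ω)`, AND THE
# SCATTERING COORDINATES OF `(ν𝓕)⁻¹·φ̃_z·H^{z−2}` IN A BASIS OF `V(χ₁ʷ, χ₂; K′, ω)` ARE HOLOMORPHIC ON `{2 < Re}` (`U(2,1)_{L∕L⁺}`, PAIR CURRENCY)

Cell `pub/hodgecm-mathlib`, crux H413 = `stmt-HodgeConjecture-24833`; R90-TF section S8 «ContSpec-n½», TWIN-DAG v1 (this seat) ED. 2 corollaries announced 16:25Z ∕ 21:33Z, typed on ★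
p862227 `K2E1ChiSectionSpaceU3PairDefs` (K2-defs1).  THEOREMS ONLY (no `def`, no `instance`, no notation, no named-fact hypothesis, no `sorry`); lane `--kind proof --supports
stmt-HodgeConjecture-24833 --as helper` (count-neutral).  Closes no socket.

* §1 **`intertwinedCoeff_mem_chiSectionSpacePair`** (generic `F, E, c`, `N = 3`; `K′ ≤ K_max`): for `φ ∈ V(χ₁, χ₂; K′, ω)` measurable, the intertwined coefficient
  `g ↦ (∫_N f_z^φ(w₀ v g) dν)·H(g)^{z−2}` lies in `V(χ₁ʷ, χ₂; K′, ω)`, `χ₁ʷ = reflectChar c χ₁` — ★ row 4a `isChiSectionPair_intertwinedCoeff_three` (the pair law) + ★ row 4b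
  `intertwinedCoeff_mul_right_of_rightLaw` (the right `(K′, ω)`-law) through ★ `mem_chiSectionSpacePair`; the `N = 3` twin of ★ `K2E1ChiEisensteinSolvesXSystemU2.intertwinedCoeff_mem_chiSectionSpace`.
* §2 **`exists_scatteringCoords_of_basis_cm_three`** (CM pair): for `φ ∈ V(χ₁, χ₂; K′, ω)` continuous bounded and a basis `bV` of `V(χ₁ʷ, χ₂; K′, ω)`, coordinates `q_j` HOLOMORPHIC on
  `{2 < Re}` with `Σ_j q_j(z)·bV_j = (ν𝓕)⁻¹·φ̃_z·H^{z−2}` — ★ row 7c `exists_scatteringCoords_cm_three` with its span letter `hsp` discharged by §1; the `N = 3` twin of ★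
  `exists_scatteringCoords_of_basis_cm_two`.
[BernsteinLapid2019, §4 p. 10, §7; MoeglinWaldspurger1995, II.1.7, I.2.17.]
HONEST LABEL: HC_CM is proved only modulo the 7 printed citations (2 remaining named inputs: hLiu418 = `stmt-HodgeConjecture-24832`, h413 = `stmt-HodgeConjecture-24833`) until rung 0
closes; count-neutral helper, closes no socket.

## References
* [BernsteinLapid2019] J. Bernstein, E. Lapid, *On the meromorphic continuation of Eisenstein series*, J. Amer. Math. Soc. 37 (2024) (arXiv:1911.02342), §4 p. 10, §7.
* [MoeglinWaldspurger1995] C. Mœglin, J.-L. Waldspurger, *Spectral Decomposition and Eisenstein Series* (1995), I.2.17, II.1.7.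
-/

set_option autoImplicit false
set_option linter.dupNamespace false  -- the mandated namespace repeats the summit's segment (`HodgeConjecture.HodgeConjecture`)

noncomputable section

open MeasureTheory Measure Filter Topology Set NumberField Metric
open scoped NNReal ENNReal
open Literature.NumberTheory Literature.NumberTheory.Automorphic Literature.NumberTheory.Automorphic.UnitaryGroup AdelicGroupData
open Literature.NumberTheory.Automorphic.Arthur2013.Leaves.TECR
open Literature.NumberTheory.GaloisRepresentations (HeckeCharacter)
open Summit.HodgeConjecture.HodgeConjecture.Cruxes.H413.K2E1BorelEisensteinU
open Summit.HodgeConjecture.HodgeConjecture.Cruxes.H413.K2E1CharacterEisensteinU2Defs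
open Summit.HodgeConjecture.HodgeConjecture.Cruxes.H413.K2E1CharacterEisensteinU3PairDefs (IsChiSectionPair)
open Summit.HodgeConjecture.HodgeConjecture.Cruxes.H413.K2E1ChiSectionSpaceU3PairDefs (chiSectionSpacePair mem_chiSectionSpacePair)
open Summit.HodgeConjecture.HodgeConjecture.Cruxes.H413.K2E1ChiIntertwinedSectionU3 (isChiSectionPair_intertwinedCoeff_three)
open Summit.HodgeConjecture.HodgeConjecture.Cruxes.H413.K2E1ChiEisensteinSolvesXSystemU3 (intertwinedCoeff_mul_right_of_rightLaw)
open Summit.HodgeConjecture.HodgeConjecture.Cruxes.H413.K2E1ChiScatteringCoordsHolomorphicCMThree (exists_scatteringCoords_cm_three)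

namespace Summit.HodgeConjecture.HodgeConjecture.Cruxes.H413.K2E1ChiScatteringCoordsPairCMThree

/-! ## §1 The intertwined coefficient of `φ ∈ V(χ₁, χ₂; K′, ω)` lies in `V(χ₁ʷ, χ₂; K′, ω)` (generic `F, E, c`) -/

section Pair

variable {F E : Type} [Field F] [NumberField F] [Field E] [NumberField E] [Algebra F E] {c : E ≃ₐ[F] E}
variable [MeasurableSpace (quasiSplit F E c 3).Adelic] [BorelSpace (quasiSplit F E c 3).Adelic]

/-- **THE INTERTWINED COEFFICIENT OF A `(χ₁, χ₂)`-SECTION IS A `(χ₁ʷ, χ₂)`-SECTION WITH THE SAME RIGHT `(K′, ω)`-LAW** (`K′ ≤ K_max`, `φ` measurable): for `φ ∈ V(χ₁, χ₂; K′, ω)`,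
`g ↦ (∫_N f_z^φ(w₀ v g) dν)·H(g)^{z−2} ∈ V(reflectChar c χ₁, χ₂; K′, ω)` — the pair law is ★ `isChiSectionPair_intertwinedCoeff_three`, the right law ★ `intertwinedCoeff_mul_right_of_rightLaw`.
[cite: MoeglinWaldspurger1995, II.1.7, I.2.17] [cite: BernsteinLapid2019, §4 p. 10] -/
theorem intertwinedCoeff_mem_chiSectionSpacePair (hc : c * c = 1) (hc1 : c ≠ 1) (ν : Measure ↥(adelicUnipotent F E c 3)) [ν.IsHaarMeasure]
    {χ₁ : HeckeCharacter E} {χ₂ : ↥(TorusDict.torus c) →ₜ* ℂˣ} {K' : Subgroup (quasiSplit F E c 3).Adelic} {ω : ↥K' → ℂ}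
    (hK' : K' ≤ ((standardMaximalCompactGL 3 E).comap (adelicVal F E c 3 ((StdForm.antidiagonal 3).over E)) : Subgroup (quasiSplit F E c 3).Adelic))
    {φ : (quasiSplit F E c 3).Adelic → ℂ} (hφ : φ ∈ chiSectionSpacePair χ₁ χ₂ K' ω) (hφm : Measurable φ) (z : ℂ) :
    (fun g : (quasiSplit F E c 3).Adelic =>
      (∫ v : ↥(adelicUnipotent F E c 3), flatSectionU φ z ((quasiSplit F E c 3).toAdelic (weylLongU (c : E →+* E) (rfl : (StdForm.antidiagonal 3).over E = (StdForm.antidiagonal 3).over E)) *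
        ((v : (quasiSplit F E c 3).Adelic) * g)) ∂ν) * (((borelHeight g : ℝ) : ℂ) ^ (z - 2))) ∈ chiSectionSpacePair (reflectChar c χ₁) χ₂ K' ω :=
  mem_chiSectionSpacePair (isChiSectionPair_intertwinedCoeff_three hc hc1 ν hφ.1 hφm z) fun g k => intertwinedCoeff_mul_right_of_rightLaw ν hK' hφ.2 z g k

end Pair

/-! ## §2 The scattering coordinates in a basis of `V(χ₁ʷ, χ₂; K′, ω)` are holomorphic on `{2 < Re}` (CM pair) -/

section CM

variable (L : Type) [Field L] [NumberField L] [IsCMField L]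
  [MeasurableSpace (quasiSplit (↥(maximalRealSubfield L)) L (IsCMField.complexConj L) 3).Adelic] [BorelSpace (quasiSplit (↥(maximalRealSubfield L)) L (IsCMField.complexConj L) 3).Adelic]

/-- **THE SCATTERING COORDINATES IN A BASIS OF `V(χ₁ʷ, χ₂; K′, ω)` ARE HOLOMORPHIC ON `{2 < Re}`** (`U(2,1)_{L∕L⁺}`; `K′ ≤ K_max`, `φ ∈ V(χ₁, χ₂; K′, ω)` continuous bounded, `bV` a
basis of `V(reflectChar c χ₁, χ₂; K′, ω)`): coordinates `q_j` holomorphic on `{2 < Re}` with `Σ_j q_j(z)·bV_j = (ν𝓕)⁻¹·φ̃_z·H^{z−2}` there — ★ `exists_scatteringCoords_cm_three` with `hsp`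
from §1.  The `N = 3` twin of ★ `exists_scatteringCoords_of_basis_cm_two`. [cite: BernsteinLapid2019, §4 p. 10, §7] [cite: MoeglinWaldspurger1995, II.1.7] -/
theorem exists_scatteringCoords_of_basis_cm_three (ν : Measure ↥(adelicUnipotent (↥(maximalRealSubfield L)) L (IsCMField.complexConj L) 3)) [ν.IsHaarMeasure]
    {𝓕 : Set ↥(adelicUnipotent (↥(maximalRealSubfield L)) L (IsCMField.complexConj L) 3)} (h𝓕N : IsFundamentalDomain ↥(rationalUnipotent (↥(maximalRealSubfield L)) L (IsCMField.complexConj L) 3) 𝓕 ν) (h𝓕c : IsCompact (closure 𝓕))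
    {χ₁ : HeckeCharacter L} {χ₂ : ↥(TorusDict.torus (IsCMField.complexConj L)) →ₜ* ℂˣ} {K' : Subgroup (quasiSplit (↥(maximalRealSubfield L)) L (IsCMField.complexConj L) 3).Adelic} {ω : ↥K' → ℂ}
    (hK' : K' ≤ ((standardMaximalCompactGL 3 L).comap (adelicVal (↥(maximalRealSubfield L)) L (IsCMField.complexConj L) 3 ((StdForm.antidiagonal 3).over L)) : Subgroup (quasiSplit (↥(maximalRealSubfield L)) L (IsCMField.complexConj L) 3).Adelic))
    {φ : (quasiSplit (↥(maximalRealSubfield L)) L (IsCMField.complexConj L) 3).Adelic → ℂ} (hφV : φ ∈ chiSectionSpacePair χ₁ χ₂ K' ω) (hφc : Continuous φ) {Mφ : ℝ} (hφM : ∀ x, ‖φ x‖ ≤ Mφ)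
    {ι' : Type} [Fintype ι'] [DecidableEq ι'] (bV : Module.Basis ι' ℂ ↥(chiSectionSpacePair (reflectChar (IsCMField.complexConj L) χ₁) χ₂ K' ω)) :
    ∃ q : ι' → ℂ → ℂ, (∀ j, DifferentiableOn ℂ (q j) {z : ℂ | 2 < z.re}) ∧
      ∀ z : ℂ, 2 < z.re → (∑ j, q j z • ((bV j : ↥(chiSectionSpacePair (reflectChar (IsCMField.complexConj L) χ₁) χ₂ K' ω)) : (quasiSplit (↥(maximalRealSubfield L)) L (IsCMField.complexConj L) 3).Adelic → ℂ)) =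
        ((((ν 𝓕).toReal⁻¹ : ℝ)) : ℂ) • (fun g : (quasiSplit (↥(maximalRealSubfield L)) L (IsCMField.complexConj L) 3).Adelic =>
          (∫ v : ↥(adelicUnipotent (↥(maximalRealSubfield L)) L (IsCMField.complexConj L) 3), flatSectionU φ z ((quasiSplit (↥(maximalRealSubfield L)) L (IsCMField.complexConj L) 3).toAdelic
            (weylLongU ((IsCMField.complexConj L : L ≃ₐ[↥(maximalRealSubfield L)] L) : L →+* L) (rfl : (StdForm.antidiagonal 3).over L = (StdForm.antidiagonal 3).over L)) *
              ((v : (quasiSplit (↥(maximalRealSubfield L)) L (IsCMField.complexConj L) 3).Adelic) * g)) ∂ν) * (((borelHeight g : ℝ) : ℂ) ^ (z - 2))) := by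
  have hc : IsCMField.complexConj L * IsCMField.complexConj L = 1 := AlgEquiv.ext fun x => by rw [AlgEquiv.mul_apply, AlgEquiv.one_apply, IsCMField.complexConj_apply_apply]
  have hc1 : IsCMField.complexConj L ≠ 1 := IsCMField.complexConj_ne_one L
  have hli : LinearIndependent ℂ (fun j => ((bV j : ↥(chiSectionSpacePair (reflectChar (IsCMField.complexConj L) χ₁) χ₂ K' ω)) : (quasiSplit (↥(maximalRealSubfield L)) L (IsCMField.complexConj L) 3).Adelic → ℂ)) :=
    bV.linearIndependent.map' (Submodule.subtype _) (Submodule.ker_subtype _)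
  refine exists_scatteringCoords_cm_three L ν h𝓕N h𝓕c hφc hφM hli fun z _ => ?_
  have hmem := intertwinedCoeff_mem_chiSectionSpacePair hc hc1 ν hK' hφV hφc.measurable z
  obtain ⟨w, hw⟩ : ∃ w : ↥(chiSectionSpacePair (reflectChar (IsCMField.complexConj L) χ₁) χ₂ K' ω), (w : (quasiSplit (↥(maximalRealSubfield L)) L (IsCMField.complexConj L) 3).Adelic → ℂ) =
      (fun g : (quasiSplit (↥(maximalRealSubfield L)) L (IsCMField.complexConj L) 3).Adelic =>
        (∫ v : ↥(adelicUnipotent (↥(maximalRealSubfield L)) L (IsCMField.complexConj L) 3), flatSectionU φ z ((quasiSplit (↥(maximalRealSubfield L)) L (IsCMField.complexConj L) 3).toAdelic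
          (weylLongU ((IsCMField.complexConj L : L ≃ₐ[↥(maximalRealSubfield L)] L) : L →+* L) (rfl : (StdForm.antidiagonal 3).over L = (StdForm.antidiagonal 3).over L)) *
            ((v : (quasiSplit (↥(maximalRealSubfield L)) L (IsCMField.complexConj L) 3).Adelic) * g)) ∂ν) * (((borelHeight g : ℝ) : ℂ) ^ (z - 2))) := ⟨⟨_, hmem⟩, rfl⟩
  rw [← hw, ← bV.sum_repr w, Submodule.coe_sum]
  refine Submodule.sum_mem _ fun j _ => ?_
  rw [Submodule.coe_smul]
  exact Submodule.smul_mem _ _ (Submodule.subset_span ⟨j, rfl⟩)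

end CM

end Summit.HodgeConjecture.HodgeConjecture.Cruxes.H413.K2E1ChiScatteringCoordsPairCMThree

end
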